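import Literature.NumberTheory.Automorphic.ShimuraCurveCartanLevelHeckeCosets
import Literature.NumberTheory.Automorphic.QuaternionOrderResidueStrongApproximation
import HarnessLib

/-!
# Strong approximation for the Cartan order at a Cartan place, and a common reduction of two
# Hecke elements of a Cartan-level Shimura curve

Topic `NumberTheory/Automorphic`; theorems only (no definition, no named fact, no instance, no
`sorry`). Let `X : CartanLevelCurveData D M C` (`ShimuraCurveCartanLevel.lean`: indefinite
quaternion algebra `B/ℚ` with real splitting `ι`, Eichler hull `O₀` of level `M`, Cartan order
`O ⊆ O₀` of level `(M; C)`), `q ∈ C` a Cartan place and `Γ = ι(O¹)`.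

* §0 (any order `P` of a quaternion algebra over `ℚ`): `reducedNorm_eq_natCast_of_det_eq`
  (`nrd x = det ι(x)`),
  `mem_of_smul_mem_of_mul_mem_of_reducedNorm` (saturation across coprime conductors:
  `n • u ∈ P`, `u x₀ ∈ P`, `nrd x₀ = ℓ`, `gcd(ℓ, n) = 1 ⇒ u ∈ P`) and
  `exists_sub_one_eq_smul_of_mul_eq_mul` (the congruence step of Shimura's two-sided test:
  `d a' = a b`, `a ≡ a'`, `b ≡ 1 (mod q)`, `nrd a' = ℓ` prime to `q` ⇒ `d ≡ 1 (mod q)`).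
* `not_exists_eq_smul_of_reducedNorm_prime` — an element of `O₀` of PRIME reduced norm is not in
  `q O₀` (`nrd (q y) = q² nrd y`).
* `exists_normOne_sub_eq_smul` — **strong approximation for the Cartan order `O` itself at `q`,
  residue form**: if `c ∈ O` has `nrd c ≡ 1 (mod q)` then some `g ∈ O` with `nrd g = 1` has
  `g ≡ c (mod q O)`. This is `exists_reducedNorm_eq_one_sub_eq_smul_of_prime`
  (`QuaternionOrderResidueStrongApproximation.lean`, Eichler–Kneser in residue form for ANY order)
  applied to `O`; at `q = 2` the parity witness it asks for is `y = η̄ c` with `η ∈ O ∖ (ℤ + 2O₀)`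
  the odd-trace element of `ShimuraCurveCartanLevelHeckeCosets.lean`
  (`exists_mem_O_not_mem_int_add_smul`, `odd_trace_norm_of_not_mem`): `trd(c ȳ) = nrd(c)·trd(η)`
  is odd. In residue terms: `O¹ ↠ (O ⊗ 𝔽_q)¹ = 𝔽_{q²}¹`, the norm-one torus.
* `exists_normOne_mul_sub_eq_smul_hull` — **common reduction**: two elements `x, x' ∈ O` of the
  same PRIME reduced norm `ℓ` are congruent modulo `q O₀` up to a norm-one unit of `O`:
  `u x ≡ x' (mod q O₀)` for some `u ∈ O`, `nrd u = 1`. (In `O ⊗ 𝔽_q ≅ 𝔽_{q²}` the residues of `x`,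
  `x'` are non-zero of the same norm `ℓ`, so their quotient has norm `1` and lifts by the previous
  theorem; written without a residue model: a left inverse `z̄` of `x` modulo `q O₀` comes from
  `isDivisionRing_mod` applied to `x̄`, and `c = x' z̄` has `nrd c ≡ 1 (mod q)`.)

Use (crux stmt-BirchSwinnertonDyer-24801, certificate for the Galois leaf (OBS), print input
(SIMREP) «simultaneous Hecke representatives»): left-multiplying the representatives of
`Γ ∖ ι(O(ℓ))` by such units gives representatives with ONE reduction modulo `q`, which then serve
the principal level-`q` subgroup as well (Shimura 1971 §3.3, Prop. 3.36). Filed by the BSD cell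
`bsd-stepL` (seat `defn-ty1` g42). Nothing arithmetic is asserted; BSD is proved for no curve.

## References

* M.-F. Vignéras, *Arithmétique des algèbres de quaternions*, LNM 800 (1980), Ch. III §4
  Thm. 4.3 and §5. [cite: VignerasLNM800, Ch. III §4 Thm. 4.3 and §5]
* G. Shimura, *Introduction to the arithmetic theory of automorphic functions* (1971), §3.3,
  Prop. 3.36. [cite: ShimuraIATAF1971, Prop. 3.36 and §3.3]
* D. Kohen, A. Pacetti, *Heegner points on Cartan non-split curves*, Canad. J. Math. 68 (2016),
  §1.1, §1.3. [cite: KohenPacetti2016, §1.1 and §1.3]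
-/

noncomputable section

open scoped NumberField

namespace Literature.NumberTheory.Automorphic

/-! ### 0. Order-theoretic bookkeeping: Bézout in a `ℤ`-lattice, norms from determinants, and the
two congruence steps of the two-sided test (any order of a quaternion algebra over `ℚ`) -/

section Orders

variable {B : Type*} [Ring B] [Algebra ℚ B]

/-- Bézout in a `ℤ`-module: `m • u ∈ P`, `n • u ∈ P` and `gcd(m, n) = 1` give `u ∈ P`. [folklore] -/
private theorem mem_of_natCast_smul_mem_of_coprime {V : Type*} [AddCommGroup V] {P : Submodule ℤ V} {u : V}
    {m n : ℕ} (hmn : m.Coprime n) (hm : (m : ℤ) • u ∈ P) (hn : (n : ℤ) • u ∈ P) : u ∈ P := by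
  obtain ⟨s, t, hst⟩ := Nat.isCoprime_iff_coprime.mpr hmn
  have e : u = s • ((m : ℤ) • u) + t • ((n : ℤ) • u) := by
    rw [smul_smul, smul_smul, ← add_smul, hst, one_smul]
  rw [e]
  exact P.add_mem (P.smul_mem s hm) (P.smul_mem t hn)

variable [IsQuaternionAlgebra ℚ B]

/-- The reduced norm of `x` is read off from the determinant of its image under a real splitting
(`det ι(x) = nrd x`, `AlgHom.det_eq_reducedNorm`). [cite: VignerasLNM800, Ch. I §2 (h ↦ ι(h), n = det)] -/
theorem reducedNorm_eq_natCast_of_det_eq (ι : B →ₐ[ℚ] Matrix (Fin 2) (Fin 2) ℝ) {x : B}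
    {g : Matrix (Fin 2) (Fin 2) ℝ} {n : ℕ} (hx : ι x = g) (hdet : g.det = n) :
    reducedNorm ℚ B x = n := by
  have h1 : ((reducedNorm ℚ B x : ℚ) : ℝ) = (n : ℝ) := by
    rw [← eq_ratCast (algebraMap ℚ ℝ), ← AlgHom.det_eq_reducedNorm ι, hx, hdet]
  exact_mod_cast h1

/-- **Saturation across coprime conductors.** Let `P` be an order, `x₀ ∈ P` of reduced norm `ℓ`, and
`u` with `n • u ∈ P` and `u x₀ ∈ P`, where `gcd(ℓ, n) = 1`; then `u ∈ P`
(`ℓ • u = (u x₀) x̄₀ ∈ P` and Bézout). [cite: VignerasLNM800, Ch. I §4 Lemme 4.12] -/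
theorem mem_of_smul_mem_of_mul_mem_of_reducedNorm {P : Submodule ℤ B} (hP : Brandt.IsOrder B P)
    {n ℓ : ℕ} (hℓn : ℓ.Coprime n) {u x₀ : B} (hnu : (n : ℤ) • u ∈ P) (hx₀ : x₀ ∈ P)
    (hn₀ : reducedNorm ℚ B x₀ = ℓ) (hux : u * x₀ ∈ P) : u ∈ P := by
  have e : (ℓ : ℤ) • u = u * x₀ * standardInvolution ℚ B x₀ := by
    rw [mul_assoc, mul_standardInvolution_holds ℚ B x₀, hn₀, ← Algebra.commutes, ← Algebra.smul_def,
      ← Int.cast_smul_eq_zsmul ℚ, Int.cast_natCast]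
  refine mem_of_natCast_smul_mem_of_coprime hℓn ?_ hnu
  rw [e]
  exact hP.mul_mem _ hux _ (hP.standardInvolution_mem hx₀)

/-- **The congruence step of the two-sided test** (Shimura 1971, proof of Prop. 3.36). In an order
`O`, let `a ≡ a' (mod q O)` with `nrd a' = ℓ`, `gcd(ℓ, q) = 1`, `b ≡ 1 (mod q O)` and `d ∈ O` with
`d a' = a b`; then `d ≡ 1 (mod q O)` (`ℓ • d = a b ā' ≡ a' ā' = ℓ`, then Bézout).
[cite: ShimuraIATAF1971, Prop. 3.36 and §3.3] -/
theorem exists_sub_one_eq_smul_of_mul_eq_mul {O : Submodule ℤ B} (hO : Brandt.IsOrder B O)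
    {q ℓ : ℕ} (hℓq : ℓ.Coprime q) {a a' b d : B} (ha' : a' ∈ O) (hd : d ∈ O)
    (hna' : reducedNorm ℚ B a' = ℓ) (hcongr : ∃ w ∈ O, a - a' = (q : ℤ) • w)
    (hb : ∃ y ∈ O, b - 1 = (q : ℤ) • y) (h : d * a' = a * b) :
    ∃ y ∈ O, d - 1 = (q : ℤ) • y := by
  obtain ⟨w, hw, haw⟩ := hcongr
  obtain ⟨y, hy, hby⟩ := hb
  have hbO : b ∈ O := by
    have e : b = 1 + (q : ℤ) • y := by rw [← hby]; abel
    rw [e]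
    exact O.add_mem hO.one_mem (O.smul_mem _ hy)
  set ab : B := standardInvolution ℚ B a' with hab
  have habO : ab ∈ O := hO.standardInvolution_mem ha'
  -- `ℓ • d = d a' ā' = a b ā'` and `ℓ • 1 = a' ā'`
  have e1 : (ℓ : ℤ) • d = a * b * ab := by
    rw [← h, mul_assoc, hab, mul_standardInvolution_holds ℚ B a', hna', ← Algebra.commutes,
      ← Algebra.smul_def, ← Int.cast_smul_eq_zsmul ℚ, Int.cast_natCast]
  have e2 : (ℓ : ℤ) • (1 : B) = a' * ab := by
    rw [hab, mul_standardInvolution_holds ℚ B a', hna', Algebra.algebraMap_eq_smul_one,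
      ← Int.cast_smul_eq_zsmul ℚ, Int.cast_natCast]
  -- `ℓ • (d - 1) = q • W`
  set W : B := w * b * ab + a' * y * ab with hW
  have hWO : W ∈ O :=
    O.add_mem (hO.mul_mem _ (hO.mul_mem _ hw _ hbO) _ habO) (hO.mul_mem _ (hO.mul_mem _ ha' _ hy) _ habO)
  have e3 : (ℓ : ℤ) • (d - 1) = (q : ℤ) • W := by
    have e : a * b * ab - a' * ab = (a - a') * b * ab + a' * (b - 1) * ab := by noncomm_ring
    rw [smul_sub, e1, e2, e, haw, hby, hW]
    simp only [smul_mul_assoc, mul_smul_comm, smul_add]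
  -- Bézout
  obtain ⟨s, t, hst⟩ := Nat.isCoprime_iff_coprime.mpr hℓq
  refine ⟨s • W + t • (d - 1), O.add_mem (O.smul_mem s hWO) (O.smul_mem t (O.sub_mem hd hO.one_mem)), ?_⟩
  have e4 : d - 1 = s • ((ℓ : ℤ) • (d - 1)) + t • ((q : ℤ) • (d - 1)) := by
    rw [smul_smul, smul_smul, ← add_smul, hst, one_smul]
  rw [e3, smul_comm s, smul_comm t, ← smul_add] at e4
  exact e4

end Orders

namespace CartanLevelCurveData

variable {D M : ℕ} {C : Finset ℕ} (X : CartanLevelCurveData D M C)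

/-! ### 1. Elements of prime norm are not divisible by a Cartan prime in the hull -/

/-- An element of reduced norm a PRIME `ℓ` is not of the form `q • y`, `y ∈ O₀`, for a prime `q`
(`q² ∣ ℓ` is impossible). [cite: VignerasLNM800, Ch. I §4 Lemme 4.12] -/
theorem not_exists_eq_smul_of_reducedNorm_prime {q : ℕ} (hq : q.Prime) {x : X.B} {ℓ : ℕ}
    (hℓ : ℓ.Prime) (hx : reducedNorm ℚ X.B x = ℓ) : ¬ ∃ y ∈ X.O₀, x = (q : ℤ) • y := by
  rintro ⟨y, hy, hxy⟩
  have hdvd : (q : ℤ) ^ 2 ∣ (ℓ : ℤ) := X.sq_dvd_of_eq_smul hy hxy (by rw [hx]; norm_cast)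
  have hdvd' : q ^ 2 ∣ ℓ := by exact_mod_cast hdvd
  have hqℓ : q ∣ ℓ := (dvd_pow_self q two_ne_zero).trans hdvd'
  have hq1 : q = ℓ := (Nat.prime_dvd_prime_iff_eq hq hℓ).mp hqℓ
  subst hq1
  have h := Nat.le_of_dvd hq.pos hdvd'
  nlinarith [hq.two_le]

/-! ### 2. Strong approximation for the Cartan order at a Cartan place -/

/-- **Strong approximation for `O` at `q ∈ C` (residue form): `O¹ ↠ (O ⊗ 𝔽_q)¹`.** If `c ∈ O` has
`nrd c ≡ 1 (mod q)` then there is `g ∈ O` with `nrd g = 1` and `g − c ∈ q O`. (Eichler–Kneser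
through `exists_reducedNorm_eq_one_sub_eq_smul_of_prime`; the parity witness at `q = 2` is `η̄ c`
for the odd-trace element `η ∈ O ∖ (ℤ + 2O₀)`.) [cite: VignerasLNM800, Ch. III §4 Thm. 4.3 and §5] -/
theorem exists_normOne_sub_eq_smul {q : ℕ} (hq : q ∈ C) {c : X.B} (hc : c ∈ X.O)
    (hn : ∃ k : ℤ, reducedNorm ℚ X.B c = 1 + q * k) :
    ∃ g ∈ X.O, reducedNorm ℚ X.B g = 1 ∧ ∃ y ∈ X.O, g - c = (q : ℤ) • y := by
  have hqp : q.Prime := (X.coprime q hq).1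
  refine exists_reducedNorm_eq_one_sub_eq_smul_of_prime X.ι X.isOrder hqp hc hn ?_
  intro hq2
  subst hq2
  obtain ⟨k, hk⟩ := hn
  -- the odd-trace element `η ∈ O ∖ (ℤ + 2O₀)`
  obtain ⟨η, hη, hηq⟩ := X.exists_mem_O_not_mem_int_add_smul hq
  obtain ⟨t, n, ht, hn'⟩ := X.isOrder.exists_int_reducedTrace_reducedNorm hη
  have hodd := (X.odd_trace_norm_of_not_mem hq hη hηq ht hn').1
  obtain ⟨s, hs⟩ : Odd t := Int.not_even_iff_odd.mp (fun h => hodd (even_iff_two_dvd.mp h))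
  -- the witness `y = η̄ c`, with `ȳ = c̄ η` and `c ȳ = nrd(c) η`
  refine ⟨standardInvolution ℚ X.B η * c,
    X.isOrder.mul_mem _ (X.isOrder.standardInvolution_mem hη) _ hc, k * (2 * s + 1) + s, ?_⟩
  rw [standardInvolution_mul_rev ℚ, standardInvolution_standardInvolution ℚ, ← mul_assoc,
    mul_standardInvolution_holds ℚ X.B c, hk, Algebra.algebraMap_eq_smul_one, smul_mul_assoc,
    one_mul, map_smul, smul_eq_mul, ht, hs]
  push_cast
  ring

/-! ### 3. A common reduction modulo `q O₀` of two elements of `O` of the same prime norm -/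

/-- **Common reduction.** For `q ∈ C`, a prime `ℓ` and `x, x' ∈ O` of reduced norm `ℓ` there is
`u ∈ O` with `nrd u = 1` and `u x − x' ∈ q O₀` (the residues of `x, x'` in `O ⊗ 𝔽_q ≅ 𝔽_{q²}` are
non-zero of equal norm; their quotient, of norm one, lifts to `O¹` by `exists_normOne_sub_eq_smul`;
for `ℓ = q` the hypothesis is vacuous — `O` has no element of reduced norm `q`, as the proof shows
en route: `ℓ · nrd z ≡ 1 (mod q)`). [cite: ShimuraIATAF1971, Prop. 3.36 and §3.3] [cite: KohenPacetti2016, §1.1 and §1.3] -/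
theorem exists_normOne_mul_sub_eq_smul_hull {q : ℕ} (hq : q ∈ C) {ℓ : ℕ} (hℓ : ℓ.Prime)
    {x x' : X.B} (hx : x ∈ X.O) (hx' : x' ∈ X.O)
    (hnx : reducedNorm ℚ X.B x = ℓ) (hnx' : reducedNorm ℚ X.B x' = ℓ) :
    ∃ u ∈ X.O, reducedNorm ℚ X.B u = 1 ∧ ∃ w ∈ X.O₀, u * x - x' = (q : ℤ) • w := by
  have hqp : q.Prime := (X.coprime q hq).1
  have hO₀ : Brandt.IsOrder X.B X.O₀ := X.isEichlerOrder.isOrder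
  -- a left inverse `z̄` of `x` modulo `q O₀`, from `isDivisionRing_mod` applied to `x̄`
  set xb : X.B := standardInvolution ℚ X.B x with hxb
  have hxbO : xb ∈ X.O := X.isOrder.standardInvolution_mem hx
  have hnxb : reducedNorm ℚ X.B xb = ℓ := by rw [hxb, reducedNorm_standardInvolution, hnx]
  obtain ⟨z, hz, y, hy, hxz⟩ := X.isDivisionRing_mod q hq xb hxbO
    (X.not_exists_eq_smul_of_reducedNorm_prime hqp hℓ hnxb)
  set zb : X.B := standardInvolution ℚ X.B z with hzb
  have hzbO : zb ∈ X.O := X.isOrder.standardInvolution_mem hz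
  set yb : X.B := standardInvolution ℚ X.B y with hyb
  have hybO : yb ∈ X.O₀ := hO₀.standardInvolution_mem hy
  -- `z̄ x = 1 + q ȳ`
  have hzx : zb * x = 1 + (q : ℤ) • yb := by
    have h : standardInvolution ℚ X.B (xb * z) = standardInvolution ℚ X.B (1 + (q : ℤ) • y) := by
      rw [← hxz, add_sub_cancel]
    rw [standardInvolution_mul_rev ℚ, hxb, standardInvolution_standardInvolution ℚ,
      standardInvolution_add ℚ, standardInvolution_one ℚ, ← Int.cast_smul_eq_zsmul ℚ,
      standardInvolution_smul ℚ, Int.cast_smul_eq_zsmul] at h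
    rw [hzb, hyb]
    exact h
  -- `c = x' z̄` has `nrd c = ℓ nrd z ≡ 1 (mod q)`
  obtain ⟨ty, ny, hty, hny⟩ := hO₀.exists_int_reducedTrace_reducedNorm hy
  have hnz : (ℓ : ℚ) * reducedNorm ℚ X.B z = 1 + q * (ty + q * ny) := by
    have h := congrArg (reducedNorm ℚ X.B) hzx
    rw [reducedNorm_mul_holds ℚ X.B, hzb, reducedNorm_standardInvolution, hnx, reducedNorm_add ℚ,
      reducedNorm_one ℚ X.B, ← Int.cast_smul_eq_zsmul ℚ, reducedNorm_smul ℚ, hyb,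
      reducedNorm_standardInvolution, hny, standardInvolution_smul ℚ,
      standardInvolution_standardInvolution ℚ, one_mul, map_smul, smul_eq_mul, hty] at h
    push_cast at h ⊢
    linear_combination h
  set c : X.B := x' * zb with hc
  have hcO : c ∈ X.O := X.isOrder.mul_mem _ hx' _ hzbO
  have hnc : ∃ k : ℤ, reducedNorm ℚ X.B c = 1 + q * k := by
    refine ⟨ty + q * ny, ?_⟩
    rw [hc, reducedNorm_mul_holds ℚ X.B, hnx', hzb, reducedNorm_standardInvolution, hnz]
    push_cast
    ring
  -- strong approximation for `O` at `q`
  obtain ⟨u, huO, hnu, y₁, hy₁, huc⟩ := X.exists_normOne_sub_eq_smul hq hcO hnc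
  refine ⟨u, huO, hnu, y₁ * x + x' * yb,
    X.O₀.add_mem (X.le (X.isOrder.mul_mem _ hy₁ _ hx)) (hO₀.mul_mem _ (X.le hx') _ hybO), ?_⟩
  have e : u * x - x' = (u - c) * x + x' * (zb * x - 1) := by rw [hc]; noncomm_ring
  rw [e, huc, hzx, add_sub_cancel_left, smul_mul_assoc, mul_smul_comm, smul_add]

end CartanLevelCurveData

end Literature.NumberTheory.Automorphic

end
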